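import Summits.QuantumFields.BalabanUV.T4Continuum.Support.RegionScalarCompression
import Summits.QuantumFields.BalabanUV.T4Continuum.Support.ScalarAveragedCompressionSharp

/-!
# T⁴ programme, spine node NE2 (U1a), sub-row Δ1 «NE2⁰-Dirichlet» ∕ row B4.c (iii), supplier «B4c-SIGMA-PLATEAU», file 3 — THE REGION's
# `U = 1` COMPRESSIONS `Q′_ΩG′_ΩQ′_Ω*`, `Q′_ΩG′_Ω²Q′_Ω*` ARE COERCIVE WITH THE POLYNOMIAL-IN-`d` CONSTANT `σ₁ = (d·C₁(d) + a′)⁻¹`,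
# UNIFORMLY IN `η`, IN THE TORUS AND IN THE REGION — versus `RegionScalarCompression`'s `σ₀ = (36^d(4d + a′))⁻¹`

NE2 formalisation swarm `b2b-balaban-t4-ne2-formalise-*`, leaf 05 (gen 8), supplier item «B4c-SIGMA-PLATEAU» (the «σ₀ lever»), region half.
Leaf-07's `RegionScalarCompression` (sub-row Δ1) proves, for ONE region `Ω = blockReg n M S` (the fine sites of a set `S` of unit blocks) at
`U = 1`, `Q′_ΩG′_ΩQ′_Ω* ≥ σ₀`, `‖(Q′_ΩG′_Ω²Q′_Ω*)⁻¹‖ ≤ σ₀⁻²` with leaf-09's torus constant `σ₀`, by reading leaf-09's parabola trial function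
through the compression; `σ₀` then enters the Δ1 lineage's slice-coercivity constants (`RegionStarLineGaugeEnd`: `orbitConst … / (1 + 4d/σ₀)`,
`RegionGaugeOrbit`).  THIS FILE reads the PLATEAU trial function of files 1a/1b (`ScalarBlockPlateauFunction.trialP`, block-local, hence
Dirichlet-admissible for every union of unit blocks) through the same compression and obtains the region bounds with file 2's `σ₁`:

 * §1 the region plateau trial function `trialPR` (`= trialP` of the zero-extended `φ`, read on `Ω`): `ext_trialPR`, **`QOm_trialPR`**
   (`Q′_Ωψ_φ = (S₁/n)^d·φ`), `re_trialPR_dot`, **`re_form_DOm_trialPR_le`** (`re⟨ψ_φ, D^Ωψ_φ⟩ ≤ E·nsq φ`, file 2's `Ecoef`, via `form_toBlock`);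
 * §2 `form_ScompR_ge_of_trial` (leaf-07's `variational_abs` at `g = t·ψ`, optimised), **`form_ScompR_ge_plateau`**
   (`nsq φ/(d·Φ_d(n,m) + a′) ≤ re⟨φ, S_Ωφ⟩`, `1 ≤ m ≤ n`, by file 2's `plateau_ratio`) and **`form_ScompR_ge_sharp`** (`σ₁·nsq φ ≤ re⟨φ, S_Ωφ⟩`);
 * §3 **`form_KcompR_ge_sharp`** (`σ₁²·nsq φ ≤ re⟨φ, K_Ωφ⟩`), `coercive_KcompR_sharp`, **`opNorm_KcompR_inv_le_sharp`** (`‖K_Ω⁻¹‖ ≤ σ₁⁻²`) and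
   **`opNorm_inv_gramK_region_le_sharp`** (`‖(gramK G′_Ω Q′_Ω)⁻¹‖ ≤ n^d·σ₁⁻²`) — uniform in `n`, `M` AND `S`.

NUMBERS (a′ = 1, d = 4): `σ₁ = 5.55·10⁻³` vs `σ₀ = 3.50·10⁻⁸`; e.g. the factor `1 + 4d/σ` of the Δ1 slice constants drops from `4.6·10⁸` to `2.9·10³`
(the Δ1 files are NOT re-instantiated here).

HONEST FRAMING (T4-DAG p. 1).  [folklore] finite-dimensional variational/positivity arguments on the cell's typed `U = 1` objects; statements /
constants OURS and still crude; nothing printed is a hypothesis; leaf-07's / leaf-09's files are imported BY NAME and not edited.  Model level: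
`U = 1`, ONE region, ONE averaging scale, finite torus; the printed (3.48) of [Balaban1985BackgroundPropagators] (kernel decay, multi-region,
background field) is NOT proved — only its diagonal single-region `U = 1` operator-norm shape, as in leaf-07's file; NOT [B9] (3.23)–(3.27) as
printed; NE2 (U1a) NOT proved; spine 0/9 unchanged; NOT infinite volume / mass gap / Clay / summit progress.  HONEST DEPENDENCY: continuum YM on
T⁴ ⇐ BetaPertH ∧ nine spine estimates (0/9 proved); BetaPertH ⇐ (D1) ∧ (D4) ∧ CAP+tail; G-an2-4 gates asym, D1 and NE2/3/4.  No `sorry`.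
-/

noncomputable section

open scoped BigOperators ComplexConjugate ComplexOrder Matrix Matrix.Norms.L2Operator
open Finset

namespace Summit.QuantumFields.BalabanUV.T4Continuum.RegionScalarCompressionSharp

open Literature.MathematicalPhysics.QuantumFieldTheory.Balaban1983to89.B5Prop11Plancherel (Tor fine)
open Literature.MathematicalPhysics.QuantumFieldTheory.Balaban1983to89.B5Prop11Lower (nsq nsq_nonneg star_dotProduct_self)
open Literature.MathematicalPhysics.QuantumFieldTheory.Balaban1983to89.B5Action121 (star_mulVec_dotProduct)
open Literature.MathematicalPhysics.QuantumFieldTheory.Balaban1983to89.B5Block118 (QsOp)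
open Literature.MathematicalPhysics.QuantumFieldTheory.Balaban1983to89.B5Blocks16 (blockOf)
open Summit.QuantumFields.BalabanUV.T4Continuum
open Summit.QuantumFields.BalabanUV.T4Continuum.SubtypeCompression (Coercive isUnit_det_of_coercive opNorm_inv_le_of_coercive
  ext ext_apply_of ext_apply_of_not nsq_ext form_toBlock)
open Summit.QuantumFields.BalabanUV.T4Continuum.ScalarAveragedPropagator (DeltaPs re_form_DeltaPs re_star_dotProduct_le)
open Summit.QuantumFields.BalabanUV.T4Continuum.ScalarBlockPlateauFunction (trialP S1 QsOp_trialP nsq_PiS_trialP dirichlet_trialP_le)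
open Summit.QuantumFields.BalabanUV.T4Continuum.ScalarAveragedCompressionSharp (PhiP Ecoef Ecoef_pos plateau_ratio PhiP_le_C1 PhiP_nonneg
  sigma1 sigma1_pos)
open Summit.QuantumFields.BalabanUV.T4Continuum.RegionScalarCompression (variational_abs QOm GOm ScompR KcompR DOm_mul_GOm re_form_DOm_nonneg
  form_ScompR nsq_ScompR_le_form_KcompR inv_gramK_region_eq)
open Summit.QuantumFields.BalabanUV.T4Continuum.RegionGaugeProjection (gramK)
open Summit.QuantumFields.BalabanUV.Beta.GAN24.DirichletBoxCompression (DOm DOm_isHermitian toBlock_mulVec')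
open Summit.QuantumFields.BalabanUV.Beta.GAN24.DirichletBoxTrace (blockReg)

variable {d : ℕ}

/-! ## §1 The region plateau trial function -/

section Trial

variable (n m : ℕ) [NeZero n] (M : Fin d → ℕ) [hM : ∀ μ, NeZero (M μ)] (a' : ℝ) (S : Tor M → Prop) [DecidablePred S]

/-- the REGION PLATEAU TRIAL FUNCTION: the plateau trial function of the zero-extended `φ`, read on `Ω`. [folklore] -/
def trialPR (φ : {y // S y} → ℂ) : {x // blockReg n M S x} → ℂ := fun a => trialP n m M (ext S φ) a

/-- the torus plateau trial function of the zero-extended `φ` VANISHES OFF THE REGION (it is block-local). [folklore] -/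
theorem trialP_ext_apply_of_not (φ : {y // S y} → ℂ) {x : Tor (fine n M)} (hx : ¬ blockReg n M S x) :
    trialP n m M (ext S φ) x = 0 := by
  unfold trialP
  rw [ext_apply_of_not S φ (show ¬ S (blockOf n M x) from hx), zero_mul]

/-- hence extending the region trial function by zero gives back the torus one. [folklore] -/
theorem ext_trialPR (φ : {y // S y} → ℂ) : ext (blockReg n M S) (trialPR n m M S φ) = trialP n m M (ext S φ) := by
  funext x
  by_cases hx : blockReg n M S x
  · exact ext_apply_of (blockReg n M S) (trialPR n m M S φ) ⟨x, hx⟩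
  · rw [ext_apply_of_not _ _ hx, trialP_ext_apply_of_not n m M S φ hx]

/-- **`Q′_Ωψ_φ = (S₁/n)^d·φ`**. [folklore] -/
theorem QOm_trialPR (φ : {y // S y} → ℂ) : QOm n M S *ᵥ trialPR n m M S φ = ((((S1 n m) / (n : ℝ)) ^ d : ℝ) : ℂ) • φ := by
  unfold QOm
  rw [toBlock_mulVec', ext_trialPR, QsOp_trialP]
  funext y
  rw [Pi.smul_apply, Pi.smul_apply, ext_apply_of]

/-- `re⟨ψ_φ, Q′_Ωᴴφ⟩ = (S₁/n)^d·nsq φ`. [folklore] -/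
theorem re_trialPR_dot (φ : {y // S y} → ℂ) :
    (star (trialPR n m M S φ) ⬝ᵥ ((QOm n M S)ᴴ *ᵥ φ)).re = ((S1 n m) / (n : ℝ)) ^ d * nsq φ := by
  rw [← star_mulVec_dotProduct, QOm_trialPR, star_smul, smul_dotProduct, star_dotProduct_self, smul_eq_mul, Complex.star_def,
    Complex.conj_ofReal, ← Complex.ofReal_mul, Complex.ofReal_re]

/-- **`re⟨ψ_φ, D^Ωψ_φ⟩ ≤ E·nsq φ`** with file 2's energy coefficient `E = Ecoef d n m a′` (the torus energy of the plateau trial function of the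
zero-extended `φ`, read through the compression). [folklore] -/
theorem re_form_DOm_trialPR_le (hm : 1 ≤ m) (φ : {y // S y} → ℂ) :
    (star (trialPR n m M S φ) ⬝ᵥ (DOm n M a' (blockReg n M S) *ᵥ trialPR n m M S φ)).re ≤ Ecoef d n m a' * nsq φ := by
  unfold DOm
  rw [form_toBlock, ext_trialPR, re_form_DeltaPs, nsq_PiS_trialP, Ecoef, add_mul]
  have h1 := dirichlet_trialP_le n m M hm (ext S φ)
  rw [nsq_ext] at h1 ⊢
  have h2 : a' * ((n : ℝ) ^ d * (((S1 n m) / (n : ℝ)) ^ d) ^ 2 * nsq φ) = a' * ((n : ℝ) ^ d * (((S1 n m) / (n : ℝ)) ^ d) ^ 2) * nsq φ := by ring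
  rw [h2]; linarith [h1]

end Trial

/-! ## §2 `S_Ω = Q′_ΩG′_ΩQ′_Ω*` is coercive with the plateau constants -/

section Scomp

variable (n m : ℕ) [NeZero n] (M : Fin d → ℕ) [hM : ∀ μ, NeZero (M μ)] (a' : ℝ) (S : Tor M → Prop) [DecidablePred S]

/-- leaf-07's `variational_abs` at `g = t·ψ`, optimised in `t`: `re⟨ψ, Q′_Ωᴴφ⟩ = B·nsq φ` and `re⟨ψ, D^Ωψ⟩ ≤ E·nsq φ` (`E > 0`) give
`n^d·(B²/E)·nsq φ ≤ re⟨φ, S_Ωφ⟩`. [folklore] -/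
theorem form_ScompR_ge_of_trial (ha' : 0 < a') (φ : {y // S y} → ℂ) (ψ : {x // blockReg n M S x} → ℂ) {B E : ℝ} (hE : 0 < E)
    (hB : (star ψ ⬝ᵥ ((QOm n M S)ᴴ *ᵥ φ)).re = B * nsq φ)
    (hEψ : (star ψ ⬝ᵥ (DOm n M a' (blockReg n M S) *ᵥ ψ)).re ≤ E * nsq φ) :
    (n : ℝ) ^ d * (B ^ 2 / E) * nsq φ ≤ (star φ ⬝ᵥ (ScompR n M a' S *ᵥ φ)).re := by
  have hn : (0 : ℝ) ≤ (n : ℝ) ^ d := pow_nonneg (Nat.cast_nonneg _) d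
  set h := (QOm n M S)ᴴ *ᵥ φ with hh
  set t : ℝ := B / E with ht
  have hv := variational_abs (DOm_isHermitian n M a' (blockReg n M S)) (re_form_DOm_nonneg n M a' S ha')
    (DOm_mul_GOm n M a' S ha') ((t : ℂ) • ψ) h
  have e3 : (star ((t : ℂ) • ψ) ⬝ᵥ h).re = t * (B * nsq φ) := by
    rw [star_smul, smul_dotProduct, smul_eq_mul, Complex.star_def, Complex.conj_ofReal, Complex.re_ofReal_mul, hB]
  have e4 : (star ((t : ℂ) • ψ) ⬝ᵥ (DOm n M a' (blockReg n M S) *ᵥ ((t : ℂ) • ψ))).re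
      = t ^ 2 * (star ψ ⬝ᵥ (DOm n M a' (blockReg n M S) *ᵥ ψ)).re := by
    rw [Matrix.mulVec_smul, star_smul, smul_dotProduct, dotProduct_smul, smul_eq_mul, smul_eq_mul, Complex.star_def,
      Complex.conj_ofReal, ← mul_assoc, ← Complex.ofReal_mul, Complex.re_ofReal_mul, sq]
  rw [e3, e4] at hv
  have e5 : (star φ ⬝ᵥ (ScompR n M a' S *ᵥ φ)).re = (n : ℝ) ^ d * (star h ⬝ᵥ (GOm n M a' S *ᵥ h)).re := by
    rw [form_ScompR, ← hh, ← Complex.ofReal_natCast, ← Complex.ofReal_pow, Complex.re_ofReal_mul]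
  rw [e5, mul_assoc]
  refine mul_le_mul_of_nonneg_left ?_ hn
  have k1 : 2 * (t * (B * nsq φ)) - t ^ 2 * (E * nsq φ) = B ^ 2 / E * nsq φ := by
    rw [ht]; field_simp; ring
  have k2 : t ^ 2 * (star ψ ⬝ᵥ (DOm n M a' (blockReg n M S) *ᵥ ψ)).re ≤ t ^ 2 * (E * nsq φ) :=
    mul_le_mul_of_nonneg_left hEψ (sq_nonneg t)
  linarith

/-- **THE PARAMETRIC COERCIVITY OF `S_Ω`**: `nsq φ / (d·Φ_d(n,m) + a′) ≤ re⟨φ, S_Ωφ⟩` for every ramp width `1 ≤ m ≤ n`, every region `S`.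
[folklore] -/
theorem form_ScompR_ge_plateau (ha' : 0 < a') (hm : 1 ≤ m) (hmn : m ≤ n) (φ : {y // S y} → ℂ) :
    nsq φ / (d * PhiP d n m + a') ≤ (star φ ⬝ᵥ (ScompR n M a' S *ᵥ φ)).re := by
  have hgen := form_ScompR_ge_of_trial n M a' S ha' φ (trialPR n m M S φ) (Ecoef_pos (d := d) n m ha' hm hmn)
    (re_trialPR_dot n m M S φ) (re_form_DOm_trialPR_le n m M a' S hm φ)
  refine le_trans ?_ hgen
  rw [div_eq_mul_inv, mul_comm]
  exact mul_le_mul_of_nonneg_right (plateau_ratio (d := d) n m ha' hm hmn) (nsq_nonneg φ)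

end Scomp

section Sharp

variable (n : ℕ) [NeZero n] (M : Fin d → ℕ) [hM : ∀ μ, NeZero (M μ)] (a' : ℝ) (S : Tor M → Prop) [DecidablePred S]

/-- **`S_Ω ≥ σ₁` UNIFORMLY IN `n`, `M` AND THE REGION**: `σ₁·nsq φ ≤ re⟨φ, S_Ωφ⟩`, `σ₁ = (d·C₁(d) + a′)⁻¹`. [folklore] -/
theorem form_ScompR_ge_sharp (ha' : 0 < a') (φ : {y // S y} → ℂ) : sigma1 d a' * nsq φ ≤ (star φ ⬝ᵥ (ScompR n M a' S *ᵥ φ)).re := by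
  have hn : 1 ≤ n := Nat.pos_of_ne_zero (NeZero.ne n)
  obtain ⟨hm, hmn, hΦ⟩ := PhiP_le_C1 (d := d) (n := n) hn
  refine le_trans ?_ (form_ScompR_ge_plateau n (n / (d + 2) + 1) M a' S ha' hm hmn φ)
  rw [div_eq_mul_inv, mul_comm (nsq φ)]
  refine mul_le_mul_of_nonneg_right ?_ (nsq_nonneg φ)
  have hpos : 0 < (d : ℝ) * PhiP d n (n / (d + 2) + 1) + a' := by
    have := PhiP_nonneg (d := d) n (n / (d + 2) + 1) hmn
    positivity
  unfold sigma1
  exact inv_anti₀ hpos (by nlinarith [hΦ, (Nat.cast_nonneg d : (0 : ℝ) ≤ d)])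

/-! ## §3 `K_Ω = Q′_ΩG′_Ω²Q′_Ω* ≥ σ₁²` and `‖K_Ω⁻¹‖ ≤ σ₁⁻²`, uniformly in the region -/

/-- **`K_Ω ≥ σ₁²` UNIFORMLY IN `n`, `M` AND THE REGION**. [folklore] -/
theorem form_KcompR_ge_sharp (ha' : 0 < a') (φ : {y // S y} → ℂ) : (sigma1 d a') ^ 2 * nsq φ ≤ (star φ ⬝ᵥ (KcompR n M a' S *ᵥ φ)).re := by
  have hσ := sigma1_pos (d := d) ha'
  refine le_trans ?_ (nsq_ScompR_le_form_KcompR n M a' S φ)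
  have h1 : sigma1 d a' * nsq φ ≤ Real.sqrt (nsq φ) * Real.sqrt (nsq (ScompR n M a' S *ᵥ φ)) :=
    (form_ScompR_ge_sharp n M a' S ha' φ).trans (re_star_dotProduct_le _ _)
  have hsφ : Real.sqrt (nsq φ) ^ 2 = nsq φ := Real.sq_sqrt (nsq_nonneg _)
  have hsS : Real.sqrt (nsq (ScompR n M a' S *ᵥ φ)) ^ 2 = nsq (ScompR n M a' S *ᵥ φ) := Real.sq_sqrt (nsq_nonneg _)
  by_cases hz : nsq φ = 0
  · rw [hz, mul_zero]; exact nsq_nonneg _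
  · have hpos : 0 < nsq φ := lt_of_le_of_ne (nsq_nonneg _) (Ne.symm hz)
    have hsq0 : 0 < Real.sqrt (nsq φ) := Real.sqrt_pos.mpr hpos
    have h2 : sigma1 d a' * Real.sqrt (nsq φ) ≤ Real.sqrt (nsq (ScompR n M a' S *ᵥ φ)) := by
      have h3 : sigma1 d a' * Real.sqrt (nsq φ) * Real.sqrt (nsq φ)
          ≤ Real.sqrt (nsq (ScompR n M a' S *ᵥ φ)) * Real.sqrt (nsq φ) := by
        rw [mul_assoc, ← sq, hsφ, mul_comm (Real.sqrt _)]; exact h1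
      exact le_of_mul_le_mul_right h3 hsq0
    calc sigma1 d a' ^ 2 * nsq φ = (sigma1 d a' * Real.sqrt (nsq φ)) ^ 2 := by rw [mul_pow, hsφ]
      _ ≤ Real.sqrt (nsq (ScompR n M a' S *ᵥ φ)) ^ 2 := pow_le_pow_left₀ (mul_nonneg hσ.le (Real.sqrt_nonneg _)) h2 2
      _ = nsq (ScompR n M a' S *ᵥ φ) := hsS

/-- `K_Ω` is `σ₁²`-coercive (the owner's `Coercive` predicate). [folklore] -/
theorem coercive_KcompR_sharp (ha' : 0 < a') : Coercive (KcompR n M a' S) ((sigma1 d a') ^ 2) :=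
  fun φ => form_KcompR_ge_sharp n M a' S ha' φ

/-- **`‖K_Ω⁻¹‖ ≤ σ₁⁻²` — UNIFORM in `η = 1/n`, in the torus AND in the region `S`.** [folklore] -/
theorem opNorm_KcompR_inv_le_sharp (ha' : 0 < a') : ‖(KcompR n M a' S)⁻¹‖ ≤ ((sigma1 d a') ^ 2)⁻¹ :=
  opNorm_inv_le_of_coercive (pow_pos (sigma1_pos (d := d) ha') 2) (coercive_KcompR_sharp n M a' S ha')

/-- **`‖(gramK G′_Ω Q′_Ω)⁻¹‖ ≤ n^d·σ₁⁻²`** (the owner's (3.25) algebra in leaf-07's normalisation `K_Ω = n^d • gramK`). [folklore] -/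
theorem opNorm_inv_gramK_region_le_sharp (ha' : 0 < a') :
    ‖(gramK (GOm n M a' S) (QOm n M S))⁻¹‖ ≤ (n : ℝ) ^ d * ((sigma1 d a') ^ 2)⁻¹ := by
  rw [inv_gramK_region_eq n M a' S ha', Matrix.l2_opNorm_def, map_smul, norm_smul, norm_pow, Complex.norm_natCast,
    ← Matrix.l2_opNorm_def]
  exact mul_le_mul_of_nonneg_left (opNorm_KcompR_inv_le_sharp n M a' S ha') (pow_nonneg (Nat.cast_nonneg _) d)

end Sharp

end Summit.QuantumFields.BalabanUV.T4Continuum.RegionScalarCompressionSharp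

end
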